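import Literature.NumberTheory.EllipticCurves.Greenberg1999.H1SigmaInftyRankOne
import Literature.NumberTheory.EllipticCurves.H1SigmaDualFiniteProofs
import Literature.NumberTheory.EllipticCurves.IwasawaTwistedCoinvariantsProofs
import HarnessLib

/-!
# Input (ii) of the twisted descent for item 23110: `ψ_u(H¹(ℚ_Σ/ℚ_∞, E[p^∞])) = H¹(ℚ_Σ/ℚ_∞, E[p^∞])` for ALL BUT FINITELY
# MANY twists `u ≡ 1 (mod p)` — from the PRINTED Greenberg facts Prop. 4.12 + weak Leopoldt (route binders, BY NAME)

Route `ResidualThetaTransportAtTwo` (RTT, crux r201 `ResidualLambdaFormulaNegDiscAtTwo`, stmt-BirchSwinnertonDyer-23110; PUB binder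
`PublishedInputsGreenbergControlAtTwo` = conjuncts of `closes`' `hPubG`) / `ThetaPartnerAtTwo` (TP2). Seat `prover-bsd-wall-tp2-p2x` g12
(`--supports stmt-BirchSwinnertonDyer-23110`). THEOREMS ONLY (no definition, no named fact, no `sorry`).

WHY. Greenberg's twisted descent (LNM 1716, Prop. 4.14, p. 124) needs «`H¹(F_Σ/F_∞, M)_Γ = 0` for suitably chosen `s`», i.e.
in the tree's integer-twist convention (`Literature/…/IwasawaTwistedCoinvariantsProofs.lean`, `ψ_u = u·conj_γ − 1`):
`ψ_u(H) = H` for `H = H¹(ℚ_Σ/ℚ_∞, E[p^∞]) = unramifiedOutside (ker κ) E[p^∞] p S₀`. Print derives it from «`H¹(F_Σ/F_∞, E[p^∞])`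
has no proper `Λ`-submodules of finite index» (Prop. 4.9 / Prop. 4.12) and a generic choice of `s`. THIS FILE composes three
tree items: the THEOREM `Greenberg1999.finite_dual_H1Sigma_holds` (a finitely generated Pontryagin-dual datum `(Y, dY)` of `H`
exists), the NAMED FACTS `Greenberg1999.h1SigmaInfty_rank_eq_one` (weak Leopoldt: `rank_Λ Y = 1`, Kato Thm. 12.4 / LNM 1716 p. 140)
and `Greenberg1999.prop412_noFiniteSubmodule_H1Sigma_of_rank_one` (Prop. 4.12: then `Y` has no non-zero finite `Λ`-submodule) —
both conjuncts of the routes' PUB binder `PublishedInputsGreenbergControlAtTwo`, taken BY NAME as hypotheses — and t42's generic-twist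
lemma `IwasawaDual.finite_setOf_not_forall_exists` (`X[T − c] ≠ 0` for finitely many `c ∈ 𝔪` only):

* `finite_setOf_not_twistedCoinv_H1Sigma_of_print` — for `E/ℚ` globally minimal, ANY prime `p`, the cyclotomic `ℤ_p`-extension
  `κ` with topological generator `γ`, and `S₀` with good reduction outside `S₀ ∪ {p}`: the set of `u ∈ ℤ` with `p ∣ u − 1` for which
  `ψ_u(H) ≠ H` (some `h ∈ H` is not of the form `u·conj_γ h' − h'`, `h' ∈ H`) is FINITE;
* `exists_twistedCoinv_H1Sigma_of_print` — hence, avoiding any given finite set of twists, some `u ≡ 1 (mod p)` has `ψ_u(H) = H`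
  (the form consumed by `SignedEC.TwistedSurj.twistedCoinv_sharp_of_ambient`, hypothesis `hH`).

HONEST FRAMING: CONDITIONAL on the two printed facts (displayed hypotheses `hWL`, `h412`; no `_holds` exists: Kato's Euler-system
bound and Λ-adic duality are not in the tree); closes nothing; BSD is not proved by any of this.
References: [GreenbergLNM1716] §4 Prop. 4.9 p. 113, Prop. 4.12 p. 119, Prop. 4.14 p. 124, §5 p. 140; [Kato2004Asterisque] Thm. 12.4.
-/

set_option autoImplicit false
-- the Theorems namespace of this sub repeats the summit name by design (D-0017 nested layout)
set_option linter.dupNamespace false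

noncomputable section

open scoped Classical NumberField

open NumberField IsDedekindDomain

namespace Summit.BirchSwinnertonDyer.BirchSwinnertonDyer.Theorems.SignedEC.TwistedSurj

open Literature.NumberTheory.EllipticCurves WeierstrassCurve ZpExtension
  Literature.NumberTheory.EllipticCurves.GreenbergVatsal2000

/-- **Generic twisted coinvariant vanishing of `H¹(ℚ_Σ/ℚ_∞, E[p^∞])` from print.** `E/ℚ` globally minimal, `p` any prime,
`κ` the cyclotomic `ℤ_p`-extension with topological generator `γ`, `S₀` a finite set of places with good reduction outside
`S₀ ∪ {p}`; `H = unramifiedOutside (ker κ) E[p^∞] p S₀`. Granted weak Leopoldt (`Greenberg1999.h1SigmaInfty_rank_eq_one`) and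
Prop. 4.12 (`Greenberg1999.prop412_noFiniteSubmodule_H1Sigma_of_rank_one`) BY NAME: the set of integers `u ≡ 1 (mod p)` such that
NOT every `h ∈ H` is `u·conj_γ h' − h'` with `h' ∈ H` is finite. (The f.g. dual datum is the tree theorem
`Greenberg1999.finite_dual_H1Sigma_holds`; genericity is `IwasawaDual.finite_setOf_not_forall_exists`.)
[cite: GreenbergLNM1716, §4 Prop. 4.12 (p. 119), Prop. 4.14 (p. 124), §5 p. 140] [cite: Kato2004Asterisque, Thm. 12.4] -/
theorem finite_setOf_not_twistedCoinv_H1Sigma_of_print (hWL : Greenberg1999.h1SigmaInfty_rank_eq_one)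
    (h412 : Greenberg1999.prop412_noFiniteSubmodule_H1Sigma_of_rank_one)
    (W : WeierstrassCurve ℚ) [W.IsElliptic] [W.IsGloballyMinimal] (p : ℕ) [Fact p.Prime]
    (κ : ZpExtension ℚ p) (γ : Field.absoluteGaloisGroup ℚ) (hκ : κ.IsCyclotomic) (hγ : κ.IsTopGenerator γ)
    (S₀ : Finset (HeightOneSpectrum (𝓞 ℚ)))
    (hgood : ∀ v : HeightOneSpectrum (𝓞 ℚ), v ∉ S₀ → ((p : ℕ) : 𝓞 ℚ) ∉ v.asIdeal → W.HasGoodReductionAt v) :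
    {u : ℤ | (p : ℤ) ∣ u - 1 ∧ ¬ ∀ h ∈ unramifiedOutside κ.kerSubgroup (W.geomPrimaryTorsion p) p (↑S₀ : Set (HeightOneSpectrum (𝓞 ℚ))),
      ∃ h' ∈ unramifiedOutside κ.kerSubgroup (W.geomPrimaryTorsion p) p (↑S₀ : Set (HeightOneSpectrum (𝓞 ℚ))),
        u • W.conjH1 p κ.kerSubgroup γ h' - h' = h}.Finite := by
  set H := unramifiedOutside κ.kerSubgroup (W.geomPrimaryTorsion p) p (↑S₀ : Set (HeightOneSpectrum (𝓞 ℚ))) with hHdef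
  -- the f.g. dual datum of `H` (THEOREM) and its two printed properties (BY NAME)
  obtain ⟨Y, _, _, _, dY, hbij, hT, hC⟩ := Greenberg1999.finite_dual_H1Sigma_holds W p κ γ hκ hγ S₀ hgood
  have hrank : Module.rank (IwasawaAlgebra p) Y = 1 := hWL W p κ γ hκ hγ S₀ hgood Y dY hbij hT hC
  have hX : ∀ N : Submodule (IwasawaAlgebra p) Y, Finite N → N = ⊥ := h412 W p κ γ hκ hγ S₀ hgood Y dY hbij hT hC hrank
  -- `conj_γ` restricted to `H`
  let φ : AddMonoid.End H :=
    AddMonoidHom.mk' (fun c ↦ ⟨W.conjH1 p κ.kerSubgroup γ c,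
      conjH1_mem_unramifiedOutside κ.kerSubgroup (W.geomPrimaryTorsion p) p _ γ c.2⟩) fun a b ↦ by
      apply Subtype.ext
      change W.conjH1 p κ.kerSubgroup γ (a + b : W.subgroupH1 p κ.kerSubgroup) = _
      rw [map_add]; rfl
  have hφ : ∀ c : H, (φ c : W.subgroupH1 p κ.kerSubgroup) = W.conjH1 p κ.kerSubgroup γ c := fun _ ↦ rfl
  -- torsion
  have htor : ∀ c : H, ∃ k : ℕ, p ^ k • c = 0 := fun c ↦ by
    obtain ⟨k, hk⟩ := W.exists_pow_smul_subgroupH1_ker_eq_zero κ (c : W.subgroupH1 p κ.kerSubgroup)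
    exact ⟨k, Subtype.ext (by rw [AddSubgroupClass.coe_nsmul]; exact hk)⟩
  -- the generic-twist lemma
  have hfin := IwasawaDual.finite_setOf_not_forall_exists φ dY htor (fun y c ↦ hT y c) (fun a y c k hk ↦ hC a y c k hk) hbij hX
  refine hfin.subset fun u hu ↦ ⟨hu.1, fun hall ↦ hu.2 fun h hh ↦ ?_⟩
  obtain ⟨s', hs'⟩ := hall ⟨h, hh⟩
  refine ⟨s', s'.2, ?_⟩
  have e := congrArg Subtype.val hs'
  rw [AddSubgroupClass.coe_sub, AddSubgroupClass.coe_zsmul, hφ] at e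
  exact e

/-- **Some twist works.** Under the same printed facts, for every finite set `B` of excluded integers there is `u ∉ B` with
`p ∣ u − 1` and `ψ_u(H) = H` (the integers `1 + p·m`, `m ∈ ℕ`, are infinitely many). This is the input `hH` of
`SignedEC.TwistedSurj.twistedCoinv_sharp_of_ambient`, with room to avoid the finitely many twists excluded by the other steps of
Greenberg's descent. [cite: GreenbergLNM1716, §4 Prop. 4.14 (p. 124)] -/
theorem exists_twistedCoinv_H1Sigma_of_print (hWL : Greenberg1999.h1SigmaInfty_rank_eq_one)
    (h412 : Greenberg1999.prop412_noFiniteSubmodule_H1Sigma_of_rank_one)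
    (W : WeierstrassCurve ℚ) [W.IsElliptic] [W.IsGloballyMinimal] (p : ℕ) [Fact p.Prime]
    (κ : ZpExtension ℚ p) (γ : Field.absoluteGaloisGroup ℚ) (hκ : κ.IsCyclotomic) (hγ : κ.IsTopGenerator γ)
    (S₀ : Finset (HeightOneSpectrum (𝓞 ℚ)))
    (hgood : ∀ v : HeightOneSpectrum (𝓞 ℚ), v ∉ S₀ → ((p : ℕ) : 𝓞 ℚ) ∉ v.asIdeal → W.HasGoodReductionAt v)
    (B : Set ℤ) (hB : B.Finite) :
    ∃ u : ℤ, u ∉ B ∧ (p : ℤ) ∣ u - 1 ∧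
      ∀ h ∈ unramifiedOutside κ.kerSubgroup (W.geomPrimaryTorsion p) p (↑S₀ : Set (HeightOneSpectrum (𝓞 ℚ))),
        ∃ h' ∈ unramifiedOutside κ.kerSubgroup (W.geomPrimaryTorsion p) p (↑S₀ : Set (HeightOneSpectrum (𝓞 ℚ))),
          u • W.conjH1 p κ.kerSubgroup γ h' - h' = h := by
  have hfin := finite_setOf_not_twistedCoinv_H1Sigma_of_print hWL h412 W p κ γ hκ hγ S₀ hgood
  -- the bad set `B ∪ {exceptional twists}` is finite; the progression `1 + p m` is infinite
  have hinj : Function.Injective (fun m : ℕ ↦ (1 + (p : ℤ) * m : ℤ)) := fun m m' e ↦ by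
    have hp : (p : ℤ) ≠ 0 := by exact_mod_cast (Fact.out : p.Prime).ne_zero
    have e' : (1 + (p : ℤ) * m : ℤ) = 1 + (p : ℤ) * m' := e
    have := mul_left_cancel₀ hp (add_left_cancel e')
    exact_mod_cast this
  have hinf : ¬ (Set.range fun m : ℕ ↦ (1 + (p : ℤ) * m : ℤ)).Finite := Set.infinite_range_of_injective hinj
  obtain ⟨u, ⟨m, rfl⟩, hnot⟩ : ∃ u ∈ Set.range (fun m : ℕ ↦ (1 + (p : ℤ) * m : ℤ)), u ∉ B ∪ {u : ℤ | (p : ℤ) ∣ u - 1 ∧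
      ¬ ∀ h ∈ unramifiedOutside κ.kerSubgroup (W.geomPrimaryTorsion p) p (↑S₀ : Set (HeightOneSpectrum (𝓞 ℚ))),
        ∃ h' ∈ unramifiedOutside κ.kerSubgroup (W.geomPrimaryTorsion p) p (↑S₀ : Set (HeightOneSpectrum (𝓞 ℚ))),
          u • W.conjH1 p κ.kerSubgroup γ h' - h' = h} := by
    by_contra hcon
    apply hinf
    refine (hB.union hfin).subset fun u hu ↦ ?_
    by_contra hnu
    exact hcon ⟨u, hu, hnu⟩
  have hdvd : (p : ℤ) ∣ (1 + (p : ℤ) * m : ℤ) - 1 := ⟨m, by ring⟩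
  rw [Set.mem_union, not_or, Set.mem_setOf_eq, not_and, not_not] at hnot
  exact ⟨_, hnot.1, hdvd, hnot.2 hdvd⟩

end Summit.BirchSwinnertonDyer.BirchSwinnertonDyer.Theorems.SignedEC.TwistedSurj

end
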